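import Literature.NumberTheory.Transcendental.SemialgebraicMapsProofs
import Literature.ModelTheory.ExponentialFields.SemialgebraicInterior
import Mathlib.Analysis.Calculus.Deriv.Pi
import Mathlib.Analysis.Calculus.Deriv.Mul
import Mathlib.Analysis.Calculus.FDeriv.Pi
import Mathlib.Analysis.Calculus.ContDiff.Basic
import Mathlib.Algebra.MvPolynomial.PDeriv
import HarnessLib

/-!
# `C¹` `ℚ`-semialgebraic cube maps (cells of Nash cubical chains) and their faces

Vocabulary for the definition request `defn-NashChainRep` (route `KontsevichZagierPeriods/CobordismMove`,
items `CobordismInvariance` stmt-6762, `SignatureSector` stmt-6791): the cells of the cubical chains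
along which polynomial differential forms are integrated in the Kontsevich–Zagier calculus
(`KZCalculus.lean`; Kontsevich–Zagier 2001, §1.2, rule 3 "Stokes"; semialgebraic chains as in
Huber–Müller-Stach 2017, Ch. 12–13, and Bochnak–Coste–Roy 1998, §11.7).

* `closedUnitCube d = [0,1]ᵈ`, `openUnitCube d = (0,1)ᵈ ⊆ ℝᵈ = (Fin d → ℝ)`, both `ℚ`-semialgebraic.
* Calculus of polynomial maps: `hasDerivAt_aeval_update`, `fderiv_aeval_single` (`∂ᵢ p = pderiv i p`),
  `contDiff_aeval_real`.
* `NashCubeMap d N`: a map `c : ℝᵈ → ℝᴺ` which is `ℚ`-semialgebraic on the closed cube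
  (`IsSemialgebraicMapOn ℚ (closedUnitCube d) c`), `C¹` on an open neighbourhood of the closed cube, and —
  a field which classically FOLLOWS from the first two (the partial derivatives of a semialgebraic `C¹`
  function are semialgebraic: Bochnak–Coste–Roy 1998, Prop. 2.9.1 ff.; it is recorded as data because
  that theorem is not yet in the tree, and it is exactly what makes the pulled-back integrand
  semialgebraic) — whose partial derivatives `x ↦ ∂ᵢcⱼ(x) = fderiv ℝ c x (Pi.single i 1) j` are
  `ℚ`-semialgebraic functions on the closed cube. Two cube maps with the same underlying function are
  equal (`NashCubeMap.ext`), so coinciding faces cancel in free abelian groups of cube maps.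
* `NashCubeMap.ofPoly P`: polynomial maps (all fields proved), e.g. affine cells.
* `NashCubeMap.face c k ε` (`ε : Fin 2`): the face `c ∘ (x ↦ Fin.insertNth k ε x)` of a `(d+1)`-cube
  map is a `d`-cube map (all fields proved: composition with the affine face embedding, chain rule).

"Nash (`C²`) on the open cube", also listed in the request, is NOT a field: it is not inherited by
faces (which lie in the boundary of the big cube) and is not needed to form the representations; users
add it as a hypothesis where Stokes requires it.

## References

* M. Kontsevich, D. Zagier, *Periods* (2001), §1.2. [`KontsevichZagier2001`]
* J. Bochnak, M. Coste, M.-F. Roy, *Real Algebraic Geometry* (1998), §2.2 (Prop. 2.2.6), §2.9,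
  §11.7. [`BochnakCosteRoy1998`]
* A. Huber, S. Müller-Stach, *Periods and Nori Motives* (2017), Ch. 12–13. [`HuberMullerStach2017`]
-/

noncomputable section

open Set MvPolynomial Function
open Literature.ModelTheory.ExponentialFields (IsSemialgebraic)

namespace Literature.NumberTheory.Transcendental

/-! ## The cubes -/

/-- The closed unit cube `[0,1]ᵈ ⊆ ℝᵈ`. [folklore] -/
def closedUnitCube (d : ℕ) : Set (Fin d → ℝ) := Icc 0 1

/-- The open unit cube `(0,1)ᵈ ⊆ ℝᵈ` (the domain of the integral representations attached to cube
maps). [folklore] -/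
def openUnitCube (d : ℕ) : Set (Fin d → ℝ) := {x | ∀ i, x i ∈ Ioo (0 : ℝ) 1}

variable {d N : ℕ}

/-- Membership in the closed cube, coordinatewise. [folklore] -/
theorem mem_closedUnitCube_iff {x : Fin d → ℝ} : x ∈ closedUnitCube d ↔ ∀ i, x i ∈ Icc (0 : ℝ) 1 := by
  simp only [closedUnitCube, mem_Icc, Pi.le_def, Pi.zero_apply, Pi.one_apply, forall_and]

/-- Membership in the open cube, coordinatewise. [folklore] -/
theorem mem_openUnitCube_iff {y : Fin d → ℝ} : y ∈ openUnitCube d ↔ ∀ i, y i ∈ Ioo (0 : ℝ) 1 := Iff.rfl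

/-- `(0,1)ᵈ ⊆ [0,1]ᵈ`. [folklore] -/
theorem openUnitCube_subset_closedUnitCube : openUnitCube d ⊆ closedUnitCube d := fun _ hx =>
  mem_closedUnitCube_iff.mpr fun i => Ioo_subset_Icc_self (hx i)

/-- The open cube is open. [folklore] -/
theorem isOpen_openUnitCube : IsOpen (openUnitCube d) := by
  have : openUnitCube d = ⋂ i, (fun x : Fin d → ℝ => x i) ⁻¹' Ioo 0 1 := by
    ext x; simp [openUnitCube]
  rw [this]
  exact isOpen_iInter_of_finite fun i => isOpen_Ioo.preimage (continuous_apply i)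

/-- The closed cube is compact. [folklore] -/
theorem isCompact_closedUnitCube : IsCompact (closedUnitCube d) := isCompact_Icc

/-- The closed cube is `ℚ`-semialgebraic (`0 ≤ xᵢ`, `0 ≤ 1 - xᵢ`). [folklore] -/
theorem isSemialgebraic_closedUnitCube : IsSemialgebraic ℚ (closedUnitCube d) := by
  have h : closedUnitCube d = ⋂ i ∈ (Finset.univ : Finset (Fin d)),
      ({x : Fin d → ℝ | 0 ≤ aeval x (X i : MvPolynomial (Fin d) ℚ)} ∩
        {x | 0 ≤ aeval x (1 - X i : MvPolynomial (Fin d) ℚ)}) := by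
    ext x
    simp [mem_closedUnitCube_iff, sub_nonneg]
  rw [h]
  exact IsSemialgebraic.biInter _ _ fun i _ =>
    (Literature.ModelTheory.ExponentialFields.isSemialgebraic_setOf_eval_nonneg _).inter
      (Literature.ModelTheory.ExponentialFields.isSemialgebraic_setOf_eval_nonneg _)

/-- The open cube is `ℚ`-semialgebraic (`0 < xᵢ`, `0 < 1 - xᵢ`). [folklore] -/
theorem isSemialgebraic_openUnitCube : IsSemialgebraic ℚ (openUnitCube d) := by
  have h : openUnitCube d = ⋂ i ∈ (Finset.univ : Finset (Fin d)),
      ({x : Fin d → ℝ | 0 < aeval x (X i : MvPolynomial (Fin d) ℚ)} ∩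
        {x | 0 < aeval x (1 - X i : MvPolynomial (Fin d) ℚ)}) := by
    ext x
    simp [mem_openUnitCube_iff, sub_pos]
  rw [h]
  exact IsSemialgebraic.biInter _ _ fun i _ =>
    (Literature.ModelTheory.ExponentialFields.isSemialgebraic_setOf_eval_pos _).inter
      (Literature.ModelTheory.ExponentialFields.isSemialgebraic_setOf_eval_pos _)

/-! ## Calculus of polynomial maps -/

section PolyCalculus

variable {ι : Type*} [Fintype ι] [DecidableEq ι]

omit [Fintype ι] in
/-- Partial derivatives of a polynomial function: `t ↦ p(update x i t)` has derivative
`(pderiv i p)(x)` at `t = x i` (coefficients in `ℚ`, read in `ℝ`). [folklore] -/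
theorem hasDerivAt_aeval_update (p : MvPolynomial ι ℚ) (x : ι → ℝ) (i : ι) :
    HasDerivAt (fun t => aeval (Function.update x i t) p) (aeval x (pderiv i p)) (x i) := by
  induction p using MvPolynomial.induction_on with
  | C a =>
    simp only [aeval_C, pderiv_C, map_zero]
    exact hasDerivAt_const (x i) (algebraMap ℚ ℝ a)
  | add p q hp hq =>
    simp only [map_add]
    exact hp.add hq
  | mul_X p j hp =>
    have h2 : HasDerivAt (fun t => Function.update x i t j) (if j = i then 1 else 0) (x i) := by
      by_cases hji : j = i
      · subst hji
        simp only [Function.update_self, if_true]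
        exact hasDerivAt_id' (x j)
      · simp only [Function.update_of_ne hji, hji, if_false]
        exact hasDerivAt_const (x i) (x j)
    have h3 := hp.mul h2
    rw [Function.update_eq_self] at h3
    simp only [map_mul, aeval_X]
    refine h3.congr_deriv ?_
    rw [pderiv_mul, map_add, map_mul, map_mul, aeval_X, pderiv_X]
    congr 1
    simp only [Pi.single_apply]
    split_ifs <;> simp

omit [DecidableEq ι] in
/-- Polynomial functions with rational coefficients are smooth on `ℝ^ι`. [folklore] -/
theorem contDiff_aeval_real (p : MvPolynomial ι ℚ) {n : WithTop ℕ∞} :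
    ContDiff ℝ n fun x : ι → ℝ => aeval x p :=
  (Literature.ModelTheory.ExponentialFields.analyticOnNhd_aeval p).contDiff.of_le le_top

/-- The Fréchet derivative of a polynomial function on a coordinate vector is the corresponding
partial derivative: `D(p)(x) eᵢ = (pderiv i p)(x)`. [folklore] -/
theorem fderiv_aeval_single (p : MvPolynomial ι ℚ) (x : ι → ℝ) (i : ι) :
    fderiv ℝ (fun y : ι → ℝ => aeval y p) x (Pi.single i 1) = aeval x (pderiv i p) := by
  have hd : DifferentiableAt ℝ (fun y : ι → ℝ => aeval y p) x :=
    (contDiff_aeval_real (n := 1) p).contDiffAt.differentiableAt one_ne_zero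
  have hc : HasDerivAt ((fun y : ι → ℝ => aeval y p) ∘ Function.update x i)
      (fderiv ℝ (fun y : ι → ℝ => aeval y p) x (Pi.single i 1)) (x i) := by
    have h0 : HasFDerivAt (fun y : ι → ℝ => aeval y p) (fderiv ℝ (fun y : ι → ℝ => aeval y p) x)
        (Function.update x i (x i)) := by
      rw [Function.update_eq_self]
      exact hd.hasFDerivAt
    exact h0.comp_hasDerivAt (x i) (hasDerivAt_update x i (x i))
  exact hc.unique (hasDerivAt_aeval_update p x i)

end PolyCalculus

/-! ## Cube maps -/

/-- A **`C¹` `ℚ`-semialgebraic cube map** `c : [0,1]ᵈ → ℝᴺ` (a cell of a Nash cubical chain):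
`c` is `ℚ`-semialgebraic on the closed cube, `C¹` on an open neighbourhood of it, and its partial
derivatives `∂ᵢcⱼ` are `ℚ`-semialgebraic functions on the closed cube (classically a CONSEQUENCE of
the other two fields, Bochnak–Coste–Roy 1998, §2.9; kept as a field, see the module docstring). Only
the values of `c` near the closed cube matter. [cite: BochnakCosteRoy1998, §11.7] -/
structure NashCubeMap (d N : ℕ) where
  /-- The underlying map `ℝᵈ → ℝᴺ`. -/
  toFun : (Fin d → ℝ) → (Fin N → ℝ)
  /-- `c` is `ℚ`-semialgebraic on `[0,1]ᵈ`. -/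
  isSemialgebraicMapOn : IsSemialgebraicMapOn ℚ (closedUnitCube d) toFun
  /-- `c` is `C¹` on an open neighbourhood of `[0,1]ᵈ`. -/
  exists_contDiffOn : ∃ U : Set (Fin d → ℝ), IsOpen U ∧ closedUnitCube d ⊆ U ∧ ContDiffOn ℝ 1 toFun U
  /-- The partial derivatives `x ↦ ∂ᵢcⱼ(x)` are `ℚ`-semialgebraic functions on `[0,1]ᵈ`. -/
  isSemialgebraicFunOn_fderiv : ∀ (i : Fin d) (j : Fin N),
    IsSemialgebraicFunOn ℚ (closedUnitCube d) fun x => fderiv ℝ toFun x (Pi.single i 1) j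

namespace NashCubeMap

/-- A cube map coerces to its underlying function. [folklore] -/
instance : CoeFun (NashCubeMap d N) fun _ => (Fin d → ℝ) → (Fin N → ℝ) := ⟨NashCubeMap.toFun⟩

/-- A cube map is determined by its underlying function (the other fields are propositions): cube
maps with literally equal face maps are equal. [folklore] -/
@[ext]
theorem ext {c c' : NashCubeMap d N} (h : (c : (Fin d → ℝ) → (Fin N → ℝ)) = c') : c = c' := by
  cases c; cases c'; cases h; rfl

/-- `c` is differentiable at every point of the closed cube. [folklore] -/
theorem differentiableAt (c : NashCubeMap d N) {x : Fin d → ℝ} (hx : x ∈ closedUnitCube d) :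
    DifferentiableAt ℝ c x := by
  obtain ⟨U, hU, hsub, hc⟩ := c.exists_contDiffOn
  exact (hc.differentiableOn one_ne_zero).differentiableAt (hU.mem_nhds (hsub hx))

/-- `c` is continuous on the closed cube. [folklore] -/
theorem continuousOn (c : NashCubeMap d N) : ContinuousOn c (closedUnitCube d) := by
  obtain ⟨U, _, hsub, hc⟩ := c.exists_contDiffOn
  exact hc.continuousOn.mono hsub

/-! ### Polynomial cube maps -/

/-- A **polynomial cube map** `x ↦ (P₁(x), …, P_N(x))`, `Pⱼ ∈ ℚ[x₁, …, x_d]` (e.g. affine cells).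
All fields are theorems: polynomial maps are semialgebraic and smooth, and `∂ᵢPⱼ = pderiv i Pⱼ` is a
polynomial. [folklore] -/
def ofPoly (P : Fin N → MvPolynomial (Fin d) ℚ) : NashCubeMap d N where
  toFun x j := aeval x (P j)
  isSemialgebraicMapOn := isSemialgebraicMapOn_aeval isSemialgebraic_closedUnitCube P
  exists_contDiffOn := ⟨univ, isOpen_univ, subset_univ _,
    (contDiff_pi.mpr fun j => contDiff_aeval_real (P j)).contDiffOn⟩
  isSemialgebraicFunOn_fderiv i j := by
    have h : ∀ x : Fin d → ℝ, fderiv ℝ (fun x j => aeval x (P j)) x (Pi.single i 1) j =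
        aeval x (pderiv i (P j)) := fun x => by
      rw [fderiv_pi fun j => (contDiff_aeval_real (n := 1) (P j)).contDiffAt.differentiableAt
        one_ne_zero, ContinuousLinearMap.pi_apply]
      exact fderiv_aeval_single (P j) x i
    simp_rw [h]
    exact isSemialgebraicFunOn_aeval isSemialgebraic_closedUnitCube _

/-- The underlying function of a polynomial cube map. [folklore] -/
@[simp]
theorem ofPoly_apply (P : Fin N → MvPolynomial (Fin d) ℚ) (x : Fin d → ℝ) (j : Fin N) :
    ofPoly P x j = aeval x (P j) := rfl

/-! ### Faces -/

/-- The affine **face embedding** `ℝᵈ → ℝᵈ⁺¹`, `x ↦ (x₁, …, x_{k}, ε, x_{k+1}, …, x_d)` (insert the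
constant `ε ∈ {0, 1}` as `k`-th coordinate, Mathlib `Fin.insertNth`). [folklore] -/
def faceMap (k : Fin (d + 1)) (ε : Fin 2) : (Fin d → ℝ) → (Fin (d + 1) → ℝ) :=
  fun x => Fin.insertNth k ((ε : ℕ) : ℝ) x

/-- The face embedding is the polynomial map `insertNth k (C ε) X`. [folklore] -/
theorem faceMap_eq_aeval (k : Fin (d + 1)) (ε : Fin 2) (x : Fin d → ℝ) :
    faceMap k ε x = fun i => aeval x
      (Fin.insertNth (α := fun _ => MvPolynomial (Fin d) ℚ) k (C ((ε : ℕ) : ℚ)) (fun j => X j) i) := by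
  funext i
  refine Fin.succAboveCases k ?_ (fun j => ?_) i
  · simp [faceMap]
  · simp [faceMap]

/-- The linear part of the face embedding: `v ↦ insertNth k 0 v`. [folklore] -/
def faceMapLinear (k : Fin (d + 1)) : (Fin d → ℝ) →L[ℝ] (Fin (d + 1) → ℝ) :=
  ContinuousLinearMap.pi fun i =>
    Fin.insertNth (α := fun _ => (Fin d → ℝ) →L[ℝ] ℝ) k 0 (fun j => ContinuousLinearMap.proj j) i

/-- `faceMapLinear k v = insertNth k 0 v`. [folklore] -/
theorem faceMapLinear_apply (k : Fin (d + 1)) (v : Fin d → ℝ) :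
    faceMapLinear k v = Fin.insertNth k (0 : ℝ) v := by
  funext i
  refine Fin.succAboveCases k ?_ (fun j => ?_) i
  · simp [faceMapLinear]
  · simp [faceMapLinear]

/-- The face embedding is its linear part plus a constant. [folklore] -/
theorem faceMap_eq_add (k : Fin (d + 1)) (ε : Fin 2) (x : Fin d → ℝ) :
    faceMap k ε x = faceMapLinear k x + Fin.insertNth k ((ε : ℕ) : ℝ) (0 : Fin d → ℝ) := by
  rw [faceMapLinear_apply, faceMap, ← Fin.insertNth_add, zero_add, add_zero]

/-- The face embedding has derivative its linear part. [folklore] -/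
theorem hasFDerivAt_faceMap (k : Fin (d + 1)) (ε : Fin 2) (x : Fin d → ℝ) :
    HasFDerivAt (faceMap k ε) (faceMapLinear k) x := by
  have : faceMap (d := d) k ε = fun x => faceMapLinear k x + Fin.insertNth k ((ε : ℕ) : ℝ) 0 :=
    funext (faceMap_eq_add k ε)
  rw [this]
  exact (faceMapLinear k).hasFDerivAt.add_const _

/-- The face embedding is smooth. [folklore] -/
theorem contDiff_faceMap (k : Fin (d + 1)) (ε : Fin 2) {n : WithTop ℕ∞} :
    ContDiff ℝ n (faceMap (d := d) k ε) := by
  have : faceMap (d := d) k ε = fun x => faceMapLinear k x + Fin.insertNth k ((ε : ℕ) : ℝ) 0 :=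
    funext (faceMap_eq_add k ε)
  rw [this]
  exact (faceMapLinear k).contDiff.add contDiff_const

/-- The derivative of the face embedding on a coordinate vector: `D(face) eᵢ = e_{k.succAbove i}`.
[folklore] -/
theorem faceMapLinear_single (k : Fin (d + 1)) (i : Fin d) :
    faceMapLinear k (Pi.single i (1 : ℝ)) = Pi.single (k.succAbove i) 1 := by
  rw [faceMapLinear_apply]
  funext l
  refine Fin.succAboveCases k ?_ (fun j => ?_) l
  · simp
  · rw [Fin.insertNth_apply_succAbove]
    by_cases h : j = i
    · subst h; simp
    · simp [h, (Fin.succAbove_right_injective (p := k)).ne h]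

/-- The face embedding maps the closed `d`-cube into the closed `(d+1)`-cube. [folklore] -/
theorem mapsTo_faceMap (k : Fin (d + 1)) (ε : Fin 2) :
    MapsTo (faceMap k ε) (closedUnitCube d) (closedUnitCube (d + 1)) := by
  intro x hx
  rw [mem_closedUnitCube_iff] at hx ⊢
  intro l
  refine Fin.succAboveCases k ?_ (fun j => ?_) l
  · have : ((ε : ℕ) : ℝ) ∈ Icc (0 : ℝ) 1 := by
      have h := ε.isLt
      constructor
      · positivity
      · have : (ε : ℕ) ≤ 1 := by omega
        exact_mod_cast this
    simpa [faceMap] using this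
  · simpa [faceMap] using hx j

/-- The face embedding is `ℚ`-semialgebraic on the closed cube. [folklore] -/
theorem isSemialgebraicMapOn_faceMap (k : Fin (d + 1)) (ε : Fin 2) :
    IsSemialgebraicMapOn ℚ (closedUnitCube d) (faceMap k ε) := by
  have h := isSemialgebraicMapOn_aeval (R := ℝ) isSemialgebraic_closedUnitCube
    (fun i => Fin.insertNth (α := fun _ => MvPolynomial (Fin d) ℚ) k (C ((ε : ℕ) : ℚ)) (fun j => X j) i)
  exact h.congr fun x _ => (faceMap_eq_aeval k ε x).symm

/-- The **face** `c ∘ faceMap k ε` (`ε = 0, 1`) of a `(d+1)`-cube map along the `k`-th coordinate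
is a `d`-cube map: semialgebraic as a composite of semialgebraic maps (Bochnak–Coste–Roy 1998,
Prop. 2.2.6, the tree's `IsSemialgebraicMapOn.comp_holds`), `C¹` on the preimage of the
neighbourhood, and with partial derivatives `∂ᵢ(c ∘ face)ⱼ = (∂_{k.succAbove i} cⱼ) ∘ face` (chain
rule), semialgebraic by composition. [cite: BochnakCosteRoy1998, Prop. 2.2.6] -/
def face (c : NashCubeMap (d + 1) N) (k : Fin (d + 1)) (ε : Fin 2) : NashCubeMap d N where
  toFun := c ∘ faceMap k ε
  isSemialgebraicMapOn :=
    IsSemialgebraicMapOn.comp_holds c.isSemialgebraicMapOn (isSemialgebraicMapOn_faceMap k ε)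
      (mapsTo_faceMap k ε)
  exists_contDiffOn := by
    obtain ⟨U, hU, hsub, hc⟩ := c.exists_contDiffOn
    refine ⟨faceMap k ε ⁻¹' U, hU.preimage (contDiff_faceMap (n := 0) k ε).continuous,
      fun x hx => hsub (mapsTo_faceMap k ε hx), ?_⟩
    exact hc.comp (contDiff_faceMap (n := 1) k ε).contDiffOn (mapsTo_preimage _ _)
  isSemialgebraicFunOn_fderiv i j := by
    have hEq : EqOn ((fun y => fderiv ℝ c y (Pi.single (k.succAbove i) 1) j) ∘ faceMap k ε)
        (fun x => fderiv ℝ (c ∘ faceMap k ε) x (Pi.single i 1) j) (closedUnitCube d) := by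
      intro x hx
      have hcx : DifferentiableAt ℝ c (faceMap k ε x) := c.differentiableAt (mapsTo_faceMap k ε hx)
      simp only [Function.comp_apply]
      rw [fderiv_comp x hcx (hasFDerivAt_faceMap k ε x).differentiableAt,
        (hasFDerivAt_faceMap k ε x).fderiv, ContinuousLinearMap.comp_apply, faceMapLinear_single]
    exact (IsSemialgebraicFunOn.comp_isSemialgebraicMapOn_holds
      (c.isSemialgebraicFunOn_fderiv (k.succAbove i) j) (isSemialgebraicMapOn_faceMap k ε)
      (mapsTo_faceMap k ε)).congr hEq

/-- The underlying function of a face. [folklore] -/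
@[simp]
theorem face_apply (c : NashCubeMap (d + 1) N) (k : Fin (d + 1)) (ε : Fin 2) (x : Fin d → ℝ) :
    c.face k ε x = c (faceMap k ε x) := rfl

/-- The underlying function of a face, as a composite. [folklore] -/
theorem coe_face (c : NashCubeMap (d + 1) N) (k : Fin (d + 1)) (ε : Fin 2) :
    (c.face k ε : (Fin d → ℝ) → (Fin N → ℝ)) = c ∘ faceMap k ε := rfl

end NashCubeMap

end Literature.NumberTheory.Transcendental
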